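import Literature.Analysis.FluidPDE.TorusNSCriticalSobolevMonotone
import Literature.Analysis.FluidPDE.NSGalerkinEnstrophy2D
import HarnessLib

/-!
# The critical Sobolev (`Ḣ^{1/2}`) identity and energy law of the Fourier–Galerkin system on `T³`

Analysis/FluidPDE proof file (theorems only; no definitions, no named facts). Companion, at the
GALERKIN level, of `TorusNSCriticalSobolevMonotone` (the `Ḣ^{1/2}` energy inequality along
CLASSICAL solutions): the same law along solutions of the Fourier–Galerkin system `ċ = V(g, c)`
(`Torus.galerkinField` / `galerkinRHS`, `NSGalerkinFourier`), i.e. for the Galerkin approximations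
themselves, with constants independent of the frequency set `S` (of the cutoff). This is the form in
which the estimate is USED to construct solutions (Robinson–Rodrigo–Sadowski 2016, proof of
Thm 10.1: "we take the inner product of the [Galerkin] equation with `Λu_n`" and (10.16); Cor 10.2
(ii) and Ch. 10 Notes pp. 202–203 for the small-data closure, after Chemin 1992), and the honest
content of the «cutoff-uniform critical Galerkin estimate for small data» invoked by claimed
regularity proofs (cell `ns-claims`, D-0090, row C174).

Lattice normalisation of the tree (`û(k) = mFourierCoeff (complexify ∘ u) k`, characters
`e^{2πik·x}`, `|k| = (freqNormSq k)^{1/2}`, `Λ = (−Δ)^{1/2} = Torus.fracLaplacian (1/2)`, symbol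
`2π|k|`); `S` symmetric, `c` conjugate symmetric and transversal (`u = realTrigPoly S c` real,
divergence free), `g` conjugate symmetric (`G = realTrigPoly S g`):

* §1 `Λu` is the real trigonometric polynomial with coefficients `2π|k| c k`, real and divergence
  free (functional form of the tree's `Torus.fracLaplacian_realTrigPoly`);
* §2 `sum_rpow_half_mul_re_inner_galerkinField_self` — **the `Ḣ^{1/2}` master identity** (every
  dimension): `2π ∑_{k∈S} |k| Re⟪c k, V(g,c) k⟫ = −∫⟪(u·∇)u, Λu⟫ − 8π³ν ∑_{k∈S}|k|³‖c k‖² + ∫⟪G, Λu⟫`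
  — master identity I (`Torus.sum_re_inner_galerkinField_test`) tested against `a = Λu`, a smooth
  divergence-free field band-limited to `S`, so the Galerkin projection is invisible (as `A = −Δ`
  in the enstrophy identity of `NSGalerkinEnstrophy2D`);
* §3 `hasDerivWithinAt_critSobolev` — along `β' = V(g, β)`,
  `d/dt ∑_k|k|‖β k‖² = π⁻¹(−∫⟪(u·∇)u, Λu⟫ − 8π³ν∑|k|³‖β̄ k‖² + ∫⟪G, Λu⟫)`; `critSobolev_deriv_le` —
  **the law on `T³`** (unforced, mean-zero velocity): an absolute `K ≥ 0` with
  `X' ≤ −8π²ν Z + K√X·Z`, `X = ∑_k|k|‖β k‖² = ‖u‖²_{Ḣ^{1/2}}`, `Z = ∑_k|k|³‖β k‖² = ‖u‖²_{Ḣ^{3/2}}`,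
  by the tree's trilinear estimate (10.16) `NSSobolev.exists_abs_integral_inner_convect_fracLaplacian_half_le`
  and the interpolation `‖u‖²_{Ḣ¹} ≤ ‖u‖_{Ḣ^{1/2}}‖u‖_{Ḣ^{3/2}}` (Cauchy–Schwarz).

Identities and a differential inequality for finite-dimensional ODE solutions only; no regularity
claim. NOT here: the integrated small-data bound (`TorusGalerkinCriticalSobolevSmallData`).

## Mathlib / tree search

Reused: `Torus.sum_re_inner_galerkinField_test`, `Torus.fracLaplacian_realTrigPoly`,
`Torus.isDivFree_fracLaplacian`, `NSSobolev.exists_abs_integral_inner_convect_fracLaplacian_half_le`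
(model: `hasDerivWithinAt_enstrophy`). Searched `galerkinField.*frac`, `rpow_half.*galerkin`,
`hsHalf.*[Gg]alerkin`: nothing at the Galerkin level existed.

## References

* J. C. Robinson, J. L. Rodrigo, W. Sadowski, *The Three-Dimensional Navier–Stokes Equations*,
  CUP 2016, §4.1 (4.5), Thm 10.1 (proof), (10.4), (10.16), Cor 10.2 (ii), Ch. 10 Notes pp. 202–203.
  [RobinsonRodrigoSadowskiCUP2016]
* J.-Y. Chemin, SIAM J. Math. Anal. 23 (1992) 20–28 (cite-only). [Chemin1992]
-/

noncomputable section

open MeasureTheory Set Filter UnitAddTorus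
open scoped ENNReal NNReal InnerProductSpace

namespace Literature.Analysis.FluidPDE

section NS

open FunctionSpaces.Torus Torus

variable {d : Type*} [Fintype d]

/-! ### §1 `Λ = (−Δ)^{1/2}` on real trigonometric polynomials -/

section Lambda

variable {S : Finset (d → ℤ)}

/-- The symbol of `(−Δ)^{1/2}`: `(4π²|k|²)^{1/2} = 2π|k|`. [folklore] -/
private theorem fracSymbol_half_eq (k : d → ℤ) :
    fracSymbol (1 / 2 : ℝ) k = 2 * Real.pi * freqNormSq k ^ (1 / 2 : ℝ) := by
  rw [fracSymbol, Real.mul_rpow (by positivity) (freqNormSq_nonneg k)]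
  congr 1
  rw [show (4 * Real.pi ^ 2 : ℝ) = (2 * Real.pi) ^ 2 by ring, ← Real.sqrt_eq_rpow,
    Real.sqrt_sq (by positivity)]

/-- The `Λ`-multiplied coefficients `k ↦ (4π²|k|²)^{1/2} c k` are conjugate symmetric. [folklore] -/
private theorem isConjSymm_fracSymbol_smul {c : (d → ℤ) → EuclideanSpace ℂ d} (hc : IsConjSymm c)
    (θ : ℝ) : IsConjSymm fun k => ((fracSymbol θ k : ℝ) : ℂ) • c k := by
  intro k
  dsimp only
  rw [hc k, FunctionSpaces.EuclideanSpace.conjVec_smul, Complex.conj_ofReal, fracSymbol,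
    fracSymbol, freqNormSq_neg]

/-- The `Λ`-multiplied coefficients are transversal. [folklore] -/
private theorem isTransversal_fracSymbol_smul {c : (d → ℤ) → EuclideanSpace ℂ d}
    (hcT : IsTransversal S c) (θ : ℝ) :
    IsTransversal S fun k => ((fracSymbol θ k : ℝ) : ℂ) • c k := by
  intro k hk
  have h := hcT k hk
  simp only [PiLp.smul_apply, smul_eq_mul]
  calc ∑ j, (k j : ℂ) * (((fracSymbol θ k : ℝ) : ℂ) * c k j)
      = ((fracSymbol θ k : ℝ) : ℂ) * ∑ j, (k j : ℂ) * c k j := by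
        rw [Finset.mul_sum]; exact Finset.sum_congr rfl fun j _ => by ring
    _ = 0 := by rw [h, mul_zero]

/-- `Λ` of a real trigonometric polynomial is the real trigonometric polynomial with the
multiplied coefficients (functional form of `Torus.fracLaplacian_realTrigPoly`). [folklore] -/
private theorem fracLaplacian_realTrigPoly_eq (hS : ∀ k ∈ S, -k ∈ S)
    {c : (d → ℤ) → EuclideanSpace ℂ d} (hc : IsConjSymm c) (θ : ℝ) :
    fracLaplacian θ (realTrigPoly S c) =
      realTrigPoly S (fun k => ((fracSymbol θ k : ℝ) : ℂ) • c k) :=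
  funext fun x => fracLaplacian_realTrigPoly hS hc θ x

end Lambda

/-! ### §2 Master identity at the critical weight `|k|` (every dimension) -/

section Identity

variable [DecidableEq d] {S : Finset (d → ℤ)}

/-- **The `Ḣ^{1/2}` identity of the Galerkin field in differential form (every dimension).** For
`S` symmetric, `c` conjugate symmetric and transversal on `S`, `g` conjugate symmetric,
`u = realTrigPoly S c`, `G = realTrigPoly S g`, `Λ = (−Δ)^{1/2}` (`Torus.fracLaplacian (1/2)`):
`2π ∑_{k∈S} |k| Re⟪c k, galerkinField ν S g c k⟫
  = −∫⟪(u·∇)u, Λu⟫ − 8π³ν ∑_{k∈S} |k|³‖c k‖² + ∫⟪G, Λu⟫` (`|k| = (freqNormSq k)^{1/2}`).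
This is master identity I (`Torus.sum_re_inner_galerkinField_test`) tested against `a = Λu`, a
smooth divergence-free field band-limited to `S` (`Torus.fracLaplacian_realTrigPoly`,
`Torus.isDivFree_fracLaplacian`) — so the Galerkin projection is invisible, exactly as for
`A = −Δ` in the enstrophy identity —, followed by the antisymmetry `∫⟪u,(u·∇)Λu⟫ = −∫⟪(u·∇)u, Λu⟫`
and `∫⟪u, ΔΛu⟫ = −8π³∑|k|³‖c k‖²`. It is the Galerkin form of the `Ḣ^{1/2}` energy identity of
Robinson–Rodrigo–Sadowski 2016, Ch. 10 (proof of Thm 10.1: "take the inner product of the Galerkin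
equation with `Λu_n`"). [cite: RobinsonRodrigoSadowskiCUP2016, Thm 10.1 proof, (10.16)] -/
theorem sum_rpow_half_mul_re_inner_galerkinField_self (ν : ℝ) (hS : ∀ k ∈ S, -k ∈ S)
    {g c : (d → ℤ) → EuclideanSpace ℂ d} (hg : IsConjSymm g) (hc : IsConjSymm c)
    (hcT : IsTransversal S c) :
    2 * Real.pi * ∑ k ∈ S, freqNormSq k ^ (1 / 2 : ℝ) *
        (inner ℂ (c k) (galerkinField ν S g c k)).re =
      -(∫ x, ⟪FunctionSpaces.Torus.convect (realTrigPoly S c) (realTrigPoly S c) x,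
          fracLaplacian (1 / 2 : ℝ) (realTrigPoly S c) x⟫_ℝ) -
        8 * Real.pi ^ 3 * ν * ∑ k ∈ S, freqNormSq k ^ (3 / 2 : ℝ) * ‖c k‖ ^ 2 +
        ∫ x, ⟪realTrigPoly S g x, fracLaplacian (1 / 2 : ℝ) (realTrigPoly S c) x⟫_ℝ := by
  set u := realTrigPoly S c with hu_def
  set cΛ : (d → ℤ) → EuclideanSpace ℂ d :=
    fun k => ((fracSymbol (1 / 2 : ℝ) k : ℝ) : ℂ) • c k with hcΛ_def
  have hθ : (0 : ℝ) ≤ 1 / 2 := by norm_num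
  have hu : IsSmooth u := isSmooth_realTrigPoly S c
  have hudiv : IsDivFree u := isDivFree_realTrigPoly hcT
  have hΛeq : fracLaplacian (1 / 2 : ℝ) u = realTrigPoly S cΛ := fracLaplacian_realTrigPoly_eq hS hc _
  have hcΛ : IsConjSymm cΛ := isConjSymm_fracSymbol_smul hc _
  have hcΛT : IsTransversal S cΛ := isTransversal_fracSymbol_smul hcT _
  have ha : IsSmooth (fracLaplacian (1 / 2 : ℝ) u) := hu.fracLaplacian hθ
  have hadiv : IsDivFree (fracLaplacian (1 / 2 : ℝ) u) := isDivFree_fracLaplacian hθ hu hudiv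
  have hband : ∀ k ∉ S,
      mFourierCoeff (FunctionSpaces.EuclideanSpace.complexify ∘ fracLaplacian (1 / 2 : ℝ) u) k = 0 := by
    intro k hk; rw [hΛeq]; exact mFourierCoeff_realTrigPoly_eq_zero hS hcΛ hk
  have hcoef : ∀ k ∈ S,
      mFourierCoeff (FunctionSpaces.EuclideanSpace.complexify ∘ fracLaplacian (1 / 2 : ℝ) u) k = cΛ k := by
    intro k hk; rw [hΛeq, mFourierCoeff_realTrigPoly hS hcΛ, if_pos hk]
  have hI := sum_re_inner_galerkinField_test ν hS hg hc hcT ha hadiv hband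
  rw [← hu_def] at hI
  -- the left-hand side of master identity I against `Λu`
  have hL : ∑ k ∈ S, (inner ℂ (galerkinField ν S g c k)
      (mFourierCoeff (FunctionSpaces.EuclideanSpace.complexify ∘ fracLaplacian (1 / 2 : ℝ) u) k)).re =
      2 * Real.pi * ∑ k ∈ S, freqNormSq k ^ (1 / 2 : ℝ) *
        (inner ℂ (c k) (galerkinField ν S g c k)).re := by
    rw [Finset.mul_sum]
    refine Finset.sum_congr rfl fun k hk => ?_
    rw [hcoef k hk, hcΛ_def]
    dsimp only
    rw [inner_smul_right, Complex.re_ofReal_mul, ← inner_conj_symm, Complex.conj_re,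
      fracSymbol_half_eq]
    ring
  -- the physical terms
  have h1 : ∫ x, ⟪u x, FunctionSpaces.Torus.convect u (fracLaplacian (1 / 2 : ℝ) u) x⟫_ℝ =
      -∫ x, ⟪FunctionSpaces.Torus.convect u u x, fracLaplacian (1 / 2 : ℝ) u x⟫_ℝ := by
    have h := integral_inner_convect_eq_neg hu hudiv hu ha
    linarith
  have h2 : ∫ x, ⟪u x, laplacian (fracLaplacian (1 / 2 : ℝ) u) x⟫_ℝ =
      -(8 * Real.pi ^ 3 * ∑ k ∈ S, freqNormSq k ^ (3 / 2 : ℝ) * ‖c k‖ ^ 2) := by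
    have hlap : laplacian (fracLaplacian (1 / 2 : ℝ) u) = realTrigPoly S
        (fun k => -(((4 * Real.pi ^ 2 * freqNormSq k : ℝ) : ℂ) • cΛ k)) := by
      rw [hΛeq]; exact funext fun x => laplacian_realTrigPoly S cΛ x
    rw [hlap, hu_def, integral_inner_realTrigPoly_realTrigPoly hS hc (isConjSymm_laplacianCoeff hcΛ),
      Finset.mul_sum, ← Finset.sum_neg_distrib]
    refine Finset.sum_congr rfl fun k _ => ?_
    rw [hcΛ_def]
    dsimp only
    have hcc : (inner ℂ (c k) (c k)).re = ‖c k‖ ^ 2 := inner_self_eq_norm_sq (𝕜 := ℂ) (c k)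
    rw [smul_smul, inner_neg_right, Complex.neg_re, inner_smul_right, ← Complex.ofReal_mul,
      Complex.re_ofReal_mul, hcc, fracSymbol_half_eq]
    rw [show (3 / 2 : ℝ) = 1 + 1 / 2 by norm_num, Real.rpow_add' (freqNormSq_nonneg k) (by norm_num),
      Real.rpow_one]
    ring
  -- split the integral of master identity I
  have hi1 : Integrable (fun x => ⟪u x, FunctionSpaces.Torus.convect u (fracLaplacian (1 / 2 : ℝ) u) x⟫_ℝ) volume :=
    (hu.inner (hu.convect ha)).integrable
  have hi2 : Integrable (fun x => ν * ⟪u x, laplacian (fracLaplacian (1 / 2 : ℝ) u) x⟫_ℝ) volume :=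
    ((hu.inner ha.laplacian).integrable).const_mul ν
  have hi3 : Integrable (fun x => ⟪realTrigPoly S g x, fracLaplacian (1 / 2 : ℝ) u x⟫_ℝ) volume :=
    ((isSmooth_realTrigPoly S g).inner ha).integrable
  have hi12 : Integrable (fun x => ⟪u x, FunctionSpaces.Torus.convect u (fracLaplacian (1 / 2 : ℝ) u) x⟫_ℝ +
      ν * ⟪u x, laplacian (fracLaplacian (1 / 2 : ℝ) u) x⟫_ℝ) volume := hi1.add hi2
  rw [integral_add hi12 hi3, integral_add hi1 hi2, integral_const_mul, hL, h1, h2] at hI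
  linarith

end Identity

/-! ### §3 The law along Galerkin solutions: `X' = π⁻¹(−∫⟪(u·∇)u, Λu⟫ − 8π³νZ + ∫⟪G, Λu⟫)`,
and on `T³` (unforced, mean-zero): `X' ≤ −8π²νZ + K√X·Z` -/

section Law

variable [DecidableEq d] {S : Finset (d → ℤ)}

omit [DecidableEq d] in
/-- Derivative of the critical coefficient sum `∑_k |k| ‖β k‖²` along a differentiable curve in
`S → ℂ^d`: `d/dt ∑_k |k| ‖β k‖² = ∑_k |k| · 2 Re ⟪β k, β' k⟫` (`|k| = (freqNormSq k)^{1/2}`). [folklore] -/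
private theorem hasDerivWithinAt_sum_rpow_half_mul_norm_sq {β : ℝ → ↥S → EuclideanSpace ℂ d}
    {v : ↥S → EuclideanSpace ℂ d} {s : Set ℝ} {t : ℝ} (h : HasDerivWithinAt β v s t) :
    HasDerivWithinAt (fun τ => ∑ k : ↥S, freqNormSq (k : d → ℤ) ^ (1 / 2 : ℝ) * ‖β τ k‖ ^ 2)
      (∑ k : ↥S, freqNormSq (k : d → ℤ) ^ (1 / 2 : ℝ) * (2 * (inner ℂ (β t k) (v k)).re)) s t := by
  have hk : ∀ k : ↥S, HasDerivWithinAt (fun τ => β τ k) (v k) s t := fun k =>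
    (ContinuousLinearMap.proj (R := ℝ) (φ := fun _ : ↥S => EuclideanSpace ℂ d) k).hasFDerivAt
      |>.comp_hasDerivWithinAt t h
  have := HasDerivWithinAt.fun_sum (u := Finset.univ) fun k _ =>
    ((hk k).norm_sq).const_mul (freqNormSq (k : d → ℤ) ^ (1 / 2 : ℝ))
  simp only [real_inner_eq_re_inner_euclidean] at this
  convert this using 1

/-- **The `Ḣ^{1/2}` identity in differential form along a Galerkin solution (every dimension).**
If `β' = V(g, β)` within `s` at `t`, with `β t` in the Galerkin phase space and `g` real, then, with
`u = realTrigPoly S β̄(t)`, `G = realTrigPoly S ḡ`, `Λ = (−Δ)^{1/2}`,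
`d/dt ∑_k |k|‖β k‖² = π⁻¹ (−∫⟪(u·∇)u, Λu⟫ − 8π³ν ∑_{k∈S}|k|³‖β̄(t) k‖² + ∫⟪G, Λu⟫)` — the Galerkin
level of RRS 2016, proof of Thm 10.1 ("take the inner product with `Λu_n`").
[cite: RobinsonRodrigoSadowskiCUP2016, Thm 10.1 proof, (10.16)] -/
theorem hasDerivWithinAt_critSobolev (ν : ℝ) (hS : ∀ k ∈ S, -k ∈ S)
    {β : ℝ → ↥S → EuclideanSpace ℂ d} {g : ↥S → EuclideanSpace ℂ d} {s : Set ℝ} {t : ℝ}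
    (h : HasDerivWithinAt β (galerkinRHS S ν g (β t)) s t) (hβ : β t ∈ galerkinSubspace S)
    (hg : IsRealCoeff g) :
    HasDerivWithinAt
      (fun τ => ∑ k : ↥S, freqNormSq (k : d → ℤ) ^ (1 / 2 : ℝ) * ‖β τ k‖ ^ 2)
      (Real.pi⁻¹ *
        (-(∫ x, ⟪FunctionSpaces.Torus.convect (realTrigPoly S (coeffExt S (β t)))
              (realTrigPoly S (coeffExt S (β t))) x,
            fracLaplacian (1 / 2 : ℝ) (realTrigPoly S (coeffExt S (β t))) x⟫_ℝ) -
          8 * Real.pi ^ 3 * ν * ∑ k ∈ S, freqNormSq k ^ (3 / 2 : ℝ) * ‖coeffExt S (β t) k‖ ^ 2 +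
          ∫ x, ⟪realTrigPoly S (coeffExt S g) x,
            fracLaplacian (1 / 2 : ℝ) (realTrigPoly S (coeffExt S (β t))) x⟫_ℝ)) s t := by
  have h1 := hasDerivWithinAt_sum_rpow_half_mul_norm_sq h
  have h2 : ∑ k : ↥S, freqNormSq (k : d → ℤ) ^ (1 / 2 : ℝ) *
      (2 * (inner ℂ (β t k) (galerkinRHS S ν g (β t) k)).re) =
      Real.pi⁻¹ * (2 * Real.pi * ∑ k ∈ S, freqNormSq k ^ (1 / 2 : ℝ) *
        (inner ℂ (coeffExt S (β t) k)
          (galerkinField ν S (coeffExt S g) (coeffExt S (β t)) k)).re) := by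
    rw [sum_coeffExt (fun k v => freqNormSq k ^ (1 / 2 : ℝ) * (inner ℂ v
      (galerkinField ν S (coeffExt S g) (coeffExt S (β t)) k)).re), ← mul_assoc,
      show Real.pi⁻¹ * (2 * Real.pi) = 2 by field_simp, Finset.mul_sum]
    refine Finset.sum_congr rfl fun k _ => ?_
    rw [galerkinRHS_apply]
    ring
  rw [h2, sum_rpow_half_mul_re_inner_galerkinField_self ν hS (hg.isConjSymm_coeffExt hS)
    (hβ.1.isConjSymm_coeffExt hS) hβ.2.isTransversal_coeffExt] at h1
  exact h1

omit [DecidableEq d] in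
/-- The Sobolev-type coefficient sums of a real trigonometric polynomial are finite sums:
`∑'_k |k|^{2s}‖û(k)‖² = ∑_{k∈S} |k|^{2s}‖c k‖²` for `u = realTrigPoly S c`. [folklore] -/
private theorem tsum_rpow_mul_norm_sq_mFourierCoeff_realTrigPoly (hS : ∀ k ∈ S, -k ∈ S)
    {c : (d → ℤ) → EuclideanSpace ℂ d} (hc : IsConjSymm c) (r : ℝ) :
    ∑' k : d → ℤ, freqNormSq k ^ r *
        ‖mFourierCoeff (FunctionSpaces.EuclideanSpace.complexify ∘ realTrigPoly S c) k‖ ^ 2 =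
      ∑ k ∈ S, freqNormSq k ^ r * ‖c k‖ ^ 2 := by
  rw [tsum_eq_sum (s := S) fun k hk => by
    rw [mFourierCoeff_realTrigPoly_eq_zero hS hc hk, norm_zero]; ring]
  exact Finset.sum_congr rfl fun k hk => by rw [mFourierCoeff_realTrigPoly hS hc, if_pos hk]

omit [DecidableEq d] in
/-- Interpolation `X₁ ≤ √X_{1/2} · √X_{3/2}` for finite coefficient sums (Cauchy–Schwarz;
RRS 2016 (10.4) `‖u‖²_{Ḣ¹} ≤ ‖u‖_{Ḣ^{1/2}}‖u‖_{Ḣ^{3/2}}`). [cite: RobinsonRodrigoSadowskiCUP2016, §10.2 (10.4)] -/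
theorem sum_freqNormSq_mul_le_sqrt_mul_sqrt (S : Finset (d → ℤ)) (a : (d → ℤ) → ℝ)
    (ha : ∀ k, 0 ≤ a k) :
    ∑ k ∈ S, freqNormSq k ^ (1 : ℝ) * a k ≤
      Real.sqrt (∑ k ∈ S, freqNormSq k ^ (1 / 2 : ℝ) * a k) *
        Real.sqrt (∑ k ∈ S, freqNormSq k ^ (3 / 2 : ℝ) * a k) := by
  have hq : ∀ k : d → ℤ, 0 ≤ freqNormSq k := freqNormSq_nonneg
  -- Cauchy–Schwarz with `f k = √(|k|^{1/2} a k)`, `g k = √(|k|^{3/2} a k)`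
  have hcs := Finset.sum_mul_sq_le_sq_mul_sq S
    (fun k => Real.sqrt (freqNormSq k ^ (1 / 2 : ℝ) * a k))
    (fun k => Real.sqrt (freqNormSq k ^ (3 / 2 : ℝ) * a k))
  have hfg : ∀ k ∈ S, Real.sqrt (freqNormSq k ^ (1 / 2 : ℝ) * a k) *
      Real.sqrt (freqNormSq k ^ (3 / 2 : ℝ) * a k) = freqNormSq k ^ (1 : ℝ) * a k := by
    intro k _
    rw [← Real.sqrt_mul (mul_nonneg (Real.rpow_nonneg (hq k) _) (ha k)),
      show freqNormSq k ^ (1 / 2 : ℝ) * a k * (freqNormSq k ^ (3 / 2 : ℝ) * a k) =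
        (freqNormSq k ^ (1 : ℝ) * a k) ^ 2 by
          rw [show (freqNormSq k ^ (1 : ℝ) * a k) ^ 2 =
              freqNormSq k ^ (1 / 2 : ℝ) * freqNormSq k ^ (3 / 2 : ℝ) * (a k * a k) by
            rw [← Real.rpow_add' (hq k) (by norm_num), show (1 / 2 + 3 / 2 : ℝ) = 1 + 1 by norm_num,
              Real.rpow_add' (hq k) (by norm_num), Real.rpow_one]; ring]
          ring,
      Real.sqrt_sq (mul_nonneg (Real.rpow_nonneg (hq k) _) (ha k))]
  have hff : ∀ k ∈ S, Real.sqrt (freqNormSq k ^ (1 / 2 : ℝ) * a k) ^ 2 =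
      freqNormSq k ^ (1 / 2 : ℝ) * a k := fun k _ =>
    Real.sq_sqrt (mul_nonneg (Real.rpow_nonneg (hq k) _) (ha k))
  have hgg : ∀ k ∈ S, Real.sqrt (freqNormSq k ^ (3 / 2 : ℝ) * a k) ^ 2 =
      freqNormSq k ^ (3 / 2 : ℝ) * a k := fun k _ =>
    Real.sq_sqrt (mul_nonneg (Real.rpow_nonneg (hq k) _) (ha k))
  rw [Finset.sum_congr rfl hfg, Finset.sum_congr rfl hff, Finset.sum_congr rfl hgg] at hcs
  have hX : 0 ≤ ∑ k ∈ S, freqNormSq k ^ (1 / 2 : ℝ) * a k :=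
    Finset.sum_nonneg fun k _ => mul_nonneg (Real.rpow_nonneg (hq k) _) (ha k)
  have hZ : 0 ≤ ∑ k ∈ S, freqNormSq k ^ (3 / 2 : ℝ) * a k :=
    Finset.sum_nonneg fun k _ => mul_nonneg (Real.rpow_nonneg (hq k) _) (ha k)
  have h1 : 0 ≤ ∑ k ∈ S, freqNormSq k ^ (1 : ℝ) * a k :=
    Finset.sum_nonneg fun k _ => mul_nonneg (Real.rpow_nonneg (hq k) _) (ha k)
  rw [← Real.sqrt_mul hX, ← Real.sqrt_sq h1]
  exact Real.sqrt_le_sqrt hcs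

/-- **The `Ḣ^{1/2}` energy law of the unforced Galerkin system on `T³`** (Chemin 1992;
Robinson–Rodrigo–Sadowski 2016, Ch. 10 Notes pp. 202–203 with (10.16), at the Galerkin level of the
proof of Thm 10.1): for `card d = 3` there is `K ≥ 0` — independent of the viscosity, of the
(symmetric) frequency set `S` and of the solution — such that along every solution `β` of the unforced
Galerkin ODE `β' = V(0, β)` in the Galerkin phase space whose velocity `u = realTrigPoly S β̄(t)` has
zero mean, with `X = ∑_k |k|‖β k‖²` (`= ‖u‖²_{Ḣ^{1/2}}`) and `Z = ∑_k |k|³‖β k‖²`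
(`= ‖u‖²_{Ḣ^{3/2}}`): `X' ≤ −8π²ν Z + K √X · Z`. (The identity `hasDerivWithinAt_critSobolev`, the
trilinear estimate (10.16) `NSSobolev.exists_abs_integral_inner_convect_fracLaplacian_half_le` and the
interpolation `‖u‖²_{Ḣ¹} ≤ ‖u‖_{Ḣ^{1/2}}‖u‖_{Ḣ^{3/2}}`.) A differential inequality only; no claim
for large data. [cite: RobinsonRodrigoSadowskiCUP2016, Ch. 10 (10.16), (10.4), Notes pp. 202–203] -/
theorem critSobolev_deriv_le (hd : Fintype.card d = 3) :
    ∃ K : ℝ, 0 ≤ K ∧ ∀ {ν : ℝ} {S : Finset (d → ℤ)}, (∀ k ∈ S, -k ∈ S) →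
      ∀ {β : ℝ → ↥S → EuclideanSpace ℂ d} {s : Set ℝ} {t : ℝ},
      HasDerivWithinAt β (galerkinRHS S ν 0 (β t)) s t → β t ∈ galerkinSubspace S →
      HasZeroMean (realTrigPoly S (coeffExt S (β t))) →
      ∃ D : ℝ,
        HasDerivWithinAt (fun τ => ∑ k : ↥S, freqNormSq (k : d → ℤ) ^ (1 / 2 : ℝ) * ‖β τ k‖ ^ 2)
          D s t ∧
        D ≤ -(8 * Real.pi ^ 2 * ν) *
              (∑ k : ↥S, freqNormSq (k : d → ℤ) ^ (3 / 2 : ℝ) * ‖β t k‖ ^ 2) +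
            K * Real.sqrt (∑ k : ↥S, freqNormSq (k : d → ℤ) ^ (1 / 2 : ℝ) * ‖β t k‖ ^ 2) *
              (∑ k : ↥S, freqNormSq (k : d → ℤ) ^ (3 / 2 : ℝ) * ‖β t k‖ ^ 2) := by
  classical
  obtain ⟨C, hC0, hC⟩ := NSSobolev.exists_abs_integral_inner_convect_fracLaplacian_half_le (d := d) hd
  refine ⟨C / Real.pi, div_nonneg hC0 Real.pi_pos.le, fun {ν S} hS {β s t} h hβ hmean => ?_⟩
  have hg0 : IsRealCoeff (S := S) (0 : ↥S → EuclideanSpace ℂ d) := fun k l _ => by simp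
  have hD := hasDerivWithinAt_critSobolev ν hS h hβ hg0
  refine ⟨_, hD, ?_⟩
  -- notation
  set c : (d → ℤ) → EuclideanSpace ℂ d := coeffExt S (β t) with hc_def
  set u := realTrigPoly S c with hu_def
  have hc : IsConjSymm c := hβ.1.isConjSymm_coeffExt hS
  set X : ℝ := ∑ k : ↥S, freqNormSq (k : d → ℤ) ^ (1 / 2 : ℝ) * ‖β t k‖ ^ 2 with hX
  set Z : ℝ := ∑ k : ↥S, freqNormSq (k : d → ℤ) ^ (3 / 2 : ℝ) * ‖β t k‖ ^ 2 with hZ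
  have hXS : ∑ k ∈ S, freqNormSq k ^ (1 / 2 : ℝ) * ‖c k‖ ^ 2 = X :=
    sum_coeffExt (fun k v => freqNormSq k ^ (1 / 2 : ℝ) * ‖v‖ ^ 2) (β t)
  have hZS : ∑ k ∈ S, freqNormSq k ^ (3 / 2 : ℝ) * ‖c k‖ ^ 2 = Z :=
    sum_coeffExt (fun k v => freqNormSq k ^ (3 / 2 : ℝ) * ‖v‖ ^ 2) (β t)
  have hXnn : 0 ≤ X := Finset.sum_nonneg fun k _ =>
    mul_nonneg (Real.rpow_nonneg (freqNormSq_nonneg _) _) (sq_nonneg _)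
  have hZnn : 0 ≤ Z := Finset.sum_nonneg fun k _ =>
    mul_nonneg (Real.rpow_nonneg (freqNormSq_nonneg _) _) (sq_nonneg _)
  -- the force term vanishes
  have hG : ∫ x, ⟪realTrigPoly S (coeffExt S (0 : ↥S → EuclideanSpace ℂ d)) x,
      fracLaplacian (1 / 2 : ℝ) u x⟫_ℝ = 0 := by
    simp [coeffExt_zero]
  -- the trilinear bound in terms of `X`, `Z`
  have hu : IsSmooth u := isSmooth_realTrigPoly S c
  have hI := hC u hu hmean
  rw [tsum_rpow_mul_norm_sq_mFourierCoeff_realTrigPoly hS hc,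
    tsum_rpow_mul_norm_sq_mFourierCoeff_realTrigPoly hS hc, hZS] at hI
  have hX1 : ∑ k ∈ S, freqNormSq k ^ (1 : ℝ) * ‖c k‖ ^ 2 ≤ Real.sqrt X * Real.sqrt Z := by
    have h := sum_freqNormSq_mul_le_sqrt_mul_sqrt S (fun k => ‖c k‖ ^ 2) fun k => sq_nonneg _
    rwa [hXS, hZS] at h
  have hIle : |∫ x, ⟪FunctionSpaces.Torus.convect u u x, fracLaplacian (1 / 2 : ℝ) u x⟫_ℝ| ≤
      C * Real.sqrt X * Z := by
    calc |∫ x, ⟪FunctionSpaces.Torus.convect u u x, fracLaplacian (1 / 2 : ℝ) u x⟫_ℝ|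
        ≤ C * (∑ k ∈ S, freqNormSq k ^ (1 : ℝ) * ‖c k‖ ^ 2) * Real.sqrt Z := hI
      _ ≤ C * (Real.sqrt X * Real.sqrt Z) * Real.sqrt Z :=
          mul_le_mul_of_nonneg_right (mul_le_mul_of_nonneg_left hX1 hC0) (Real.sqrt_nonneg _)
      _ = C * Real.sqrt X * Z := by
          rw [mul_assoc, mul_assoc, ← mul_assoc (Real.sqrt X), mul_assoc (Real.sqrt X),
            Real.mul_self_sqrt hZnn, ← mul_assoc]
  have hIge := neg_le_of_abs_le hIle
  rw [hG, add_zero, hZS]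
  have hπ : 0 < Real.pi := Real.pi_pos
  have hkey : Real.pi⁻¹ * (-(∫ x, ⟪FunctionSpaces.Torus.convect u u x,
      fracLaplacian (1 / 2 : ℝ) u x⟫_ℝ) - 8 * Real.pi ^ 3 * ν * Z) =
      -(8 * Real.pi ^ 2 * ν) * Z + Real.pi⁻¹ *
        (-(∫ x, ⟪FunctionSpaces.Torus.convect u u x, fracLaplacian (1 / 2 : ℝ) u x⟫_ℝ)) := by
    field_simp
    ring
  rw [hkey]
  have h3 : Real.pi⁻¹ * (-(∫ x, ⟪FunctionSpaces.Torus.convect u u x,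
      fracLaplacian (1 / 2 : ℝ) u x⟫_ℝ)) ≤ C / Real.pi * Real.sqrt X * Z := by
    have hrew : C / Real.pi * Real.sqrt X * Z = Real.pi⁻¹ * (C * Real.sqrt X * Z) := by ring
    rw [hrew]
    exact mul_le_mul_of_nonneg_left (by linarith) (inv_nonneg.2 hπ.le)
  linarith

end Law

end NS

end Literature.Analysis.FluidPDE
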